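import Literature.AlgebraicGeometry.HodgeTheory.DworkSexticSingletonPurity
import Literature.AlgebraicGeometry.HodgeTheory.DworkSexticSingletonRankOfTransport
import Literature.AlgebraicGeometry.HodgeTheory.FermatClaimPermutationInvariance
import HarnessLib

/-!
# Symmetric character eigenlines of even-dimensional Fermat varieties are of Hodge type `(p,p)`;
# the flat `Γ_W`-pieces of types `(1,2,3,3,4,5)`, `(1,1,2,4,5,5)`, `(1,1,3,3,5,5)` at the Fermat sextic fourfold

Family `hodge`, layer `Literature/AlgebraicGeometry/HodgeTheory`; theorems only (no definition, no
named fact; D-0026). A sequel to `DworkSexticSingletonPurity` (purity of a RANK-ONE eigenspace whose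
inverse character is a permutation-translate, for the Dwork sextic `X_ψ` and its group `Γ_W`) and
`DworkSexticSingletonRankOfTransport` (the `Γ_W`-eigenspaces of the Fermat sextic fourfold `X⁴₆`
collect the torus eigenlines `V(α)`, `χ_α|_{Γ_W} = χ`). Written for crux K2
`FlatClassesSpannedByReflectionInvariants` (stmt-HodgeConjecture-20241) of route
`HodgeConjecture/DworkReflectionQuotients`: it supplies the FERMAT-POINT end of the deformation
argument (Katz 2009, proof of Lemma 3.1(2): "the Hodge numbers of the eigensheaves are read at the
Fermat point") for three of Katz's four flat types, with NO description of the Hodge filtration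
(no Griffiths residues, no algebraic cycles).

The mechanism is Shioda's remark that the character decomposition `Hⁿ(Xⁿₘ) = ⊕ V(α)` is compatible
with the Hodge decomposition (Proc. Japan Acad. 55A (1979) §4) together with Ran's
`conj V(α) = V(-α)` (Compositio 42 (1980) Prop. 1.7 (iii)) and `dim V(α) ≤ 1` (Prop. 1.7 (i);
tree: `fermatEigenspace_le_span_of_ne_zero`, Pham–Milnor): if the multiset of values of `α` is
SYMMETRIC under negation, `-α = α ∘ σ` for a permutation `σ` of the coordinates, then complex
conjugation followed by the pull-back along the coordinate permutation `p_σ` of `X²ʳₘ` (an algebraic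
automorphism, so type-preserving in a fixed Hodge model, Voisin I §7.3.2) maps `V(α) ∩ H^{p,q}`
conjugate-linearly and injectively into `V(α) ∩ H^{q,p}`; as `V(α)` is a line, a non-zero class of
type `(p,q)` with `p ≠ q` would also be of type `(q,p)`, which the Hodge decomposition forbids. Hence:

* §1 `fermatEigenspace_pullback_mem_hodgePQ_of_neg_eq_comp` — **for `m ≥ 1`, `r ≥ 1`, `α ≠ 0` with
  `-α = α ∘ σ`, every class of `V(α) ⊆ H²ʳ(X²ʳₘ(ℂ); ℂ)` is of type `(r,r)`** in every Hodge model;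
  multiset form `…_of_univ_val_map_neg` (the value multisets of `α` and `-α` agree) and the
  `IsOfHodgeType` form. This is the `(p,p)` case of Ran's Prop. 1.7 (ii) / Shioda's (1.7) for the
  symmetric characters, unconditionally (the tree's named fact `Ran1980_fermatEigenspace_hodgeType_pp`
  covers all characters but rests on Griffiths' residue theorem).
* §2 (the sextic fourfold, `Γ_W = μ₆⁶ ∩ ker ∏` of the Dwork pencil) —
  `DworkSextic.fermat_gammaW_eigenspace_pullback_mem_hodgePQ_two_two`: if an exponent vector `e` is not
  constant mod `6` and every TOTALLY NONZERO translate `e + r·𝟙 (mod 6)` has a value multiset symmetric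
  under negation, then the `Γ_W`-eigenspace of `χ_e` in `H⁴(X⁴₆(ℂ); ℂ)` is of type `(2,2)` (it is the
  sum of the lines `V(e + r·𝟙)`, `DworkSextic.fermat_gammaW_eigenspace_le`; the translates with a zero
  coordinate contribute nothing, `fermatEigenspace_eq_bot_of_apply_eq_zero`).
* §3 `DworkSextic.flatTypes_translate_symmetric` — Katz's flat types `j = 0, 2, 3`, i.e.
  `(1,2,3,3,4,5)`, `(1,1,2,4,5,5)`, `(1,1,3,3,5,5)`, and their conjugates `6 − e`, in every position
  `σ ∈ 𝔖₆`, satisfy that hypothesis (a `decide`: the totally nonzero translates are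
  `(1,2,3,3,4,5)`; `(1,1,2,4,5,5)`, `(4,4,5,1,2,2)`; `(1,1,3,3,5,5)`, `(3,3,5,5,1,1)`, `(5,5,1,1,3,3)` —
  all symmetric), whence **`DworkSextic.fermat_flatTypes_gammaW_eigenspace_pullback_mem_hodgePQ_two_two`:
  at the Fermat point the `Γ_W`-pieces of these three flat types (810 of the 1170 flat classes of the
  route) are pure of type `(2,2)`**. The remaining type `j = 1`, `(1,2,2,3,5,5) ~ (1,1,3,4,4,5)`, is
  NOT symmetric (`-(1,2,2,3,5,5) = (5,4,4,3,1,1)`): conjugation exchanges its two lines, and its Hodge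
  type at the Fermat point needs a genuine input (Griffiths residues at pole order `2`, or Shioda's
  semi-decomposable cycles `Shioda1979_claim_semiDecomposable`).

What this is for: combined with a `Γ_W`-equivariant parallel transport along the Dwork line (the
hypothesis of `DworkSextic.singleton_rank_le_one_of_equivariant_transport`; construction pending) and a
transport of Hodge types (equivariant semicontinuity of Hodge numbers, or Hodge–Riemann), it would give
the purity of these pieces at every `ψ⁶ ≠ 1` without Katz's / Griffiths' named facts. Nothing here
uses or asserts those facts.

## References

* [Katz2009] N. M. Katz, Another look at the Dwork family, Progr. Math. 270 (2009) 89–126, §2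
  pp. 5–7, Lemma 3.1 (and its proof, p. 8: evaluation at the Fermat point).
* [Ran1980] Z. Ran, Cycles on Fermat hypersurfaces, Compositio Math. 42 (1980) 121–142, §1 Prop. 1.7
  (i)–(iii).
* [Shioda1979HodgeFermat] T. Shioda, The Hodge conjecture for Fermat varieties, Math. Ann. 245 (1979)
  175–184, §1 (1.7).
* [Shioda1979PJA] T. Shioda, The Hodge conjecture and the Tate conjecture for Fermat varieties, Proc.
  Japan Acad. 55A (1979) 111–114, §4.
* [VoisinHodgeI2002] C. Voisin, Hodge Theory and Complex Algebraic Geometry I (2002), Cor. 6.12,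
  Thm. 6.18, §7.3.2.
-/

noncomputable section

open CategoryTheory MvPolynomial Finset
open scoped BigOperators

namespace Literature.AlgebraicGeometry.HodgeTheory

open Literature.AlgebraicGeometry.Motives Literature.AlgebraicTopology.SingularHomology

/-! ### §1 Symmetric characters of `X²ʳₘ`: `V(α) ⊆ H^{r,r}` -/

section Fermat

variable {n m : ℕ}

/-- The multiset of values of a tuple is unchanged by a permutation of the indices. [folklore] -/
private theorem univ_val_map_comp_perm {K : ℕ} {X : Type*} (x : Fin K → X) (σ : Equiv.Perm (Fin K)) :
    univ.val.map (x ∘ σ) = univ.val.map x := by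
  rw [← Multiset.map_map, Multiset.map_univ_val_equiv]

/-- **`p_σ^* V(α ∘ σ) ⊆ V(α)`**: the coordinate permutation `p_σ : [z] ↦ [z ∘ σ]` of `Xⁿₘ` pulls the
eigenline of `α ∘ σ` back into that of `α` (`map_permMap_mem_fermatEigenspace` with
`(α ∘ σ) ∘ σ⁻¹ = α`). [cite: Shioda1979HodgeFermat, §1] -/
theorem map_permMap_mem_fermatEigenspace_of_comp {α : Fin (n + 2) → ZMod m} {k : ℕ}
    (σ : Equiv.Perm (Fin (n + 2))) {c : complexBetti (fermatHypersurface n m) k}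
    (hc : c ∈ fermatEigenspace m (α ∘ σ) k) :
    singularCohomology.map ℂ ℂ (permMap (fermatPolynomial ℂ n m) (mem_permStabilizer_fermatPolynomial m σ)) k c ∈
      fermatEigenspace m α k := by
  have h := map_permMap_mem_fermatEigenspace σ hc
  have hα : (α ∘ σ) ∘ σ.symm = α := funext fun i => by simp
  rwa [hα] at h

/-- `p_σ^*` is injective on `Hᵏ(Xⁿₘ(ℂ); ℂ)`: it has the left inverse `p_{σ⁻¹}^*` (functoriality of
`H^*`). [cite: HatcherAT2002, §3.1 p. 198] [cite: Shioda1979HodgeFermat, §1] -/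
theorem map_permMap_injective (σ : Equiv.Perm (Fin (n + 2))) (k : ℕ) :
    Function.Injective
      (singularCohomology.map ℂ ℂ (permMap (fermatPolynomial ℂ n m) (mem_permStabilizer_fermatPolynomial m σ)) k) :=
  fun x y hxy => by
    have h := congrArg (singularCohomology.map ℂ ℂ
      (permMap (fermatPolynomial ℂ n m) (inv_mem (mem_permStabilizer_fermatPolynomial m σ))) k) hxy
    rwa [map_permMap_inv_map_permMap, map_permMap_inv_map_permMap] at h

variable [NeZero m] {r : ℕ}

/-- **Symmetric eigenlines are of type `(r,r)`** (Shioda (1.7) / Ran Prop. 1.7 (ii), the `(p,p)` case,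
for symmetric characters, without residues). Let `m ≥ 1`, `r ≥ 1`, `A` a Hodge model of
`X²ʳₘ = V₊(Σᵢ xᵢᵐ) ⊂ ℙ²ʳ⁺¹`, and `α ≠ 0` a character with `-α = α ∘ σ` for a permutation `σ`. Then every
class of `V(α) ⊆ H²ʳ(X²ʳₘ(ℂ); ℂ)` pulls back into `H^{r,r}_A`. Proof: for `x ∈ V(α)` of type `(p,q)`,
`p ≠ q`, the class `y = p_σ^*(conj x)` lies in `V(α)` (`conj V(α) ⊆ V(-α) = V(α ∘ σ)`,
`p_σ^* V(α ∘ σ) ⊆ V(α)`) and is of type `(q,p)` (Hodge symmetry of `A`; `p_σ` is an algebraic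
automorphism, `HodgeModel.pullback_map_mem_hodgePQ_of_endomorphism`); `V(α)` is a line
(`fermatEigenspace_le_span_of_ne_zero`) and `y ≠ 0` if `x ≠ 0`, so `x ∈ ℂ y` has two different types
and vanishes (`DworkSextic.eq_zero_of_pullback_mem_hodgePQ_of_ne`); conclude by
`pullback_mem_hodgePQ_of_eigenspace`. [cite: Shioda1979PJA, §4] [cite: Ran1980, §1 Prop. 1.7 (i)–(iii)]
[cite: VoisinHodgeI2002, Cor. 6.12 and §7.3.2] -/
theorem fermatEigenspace_pullback_mem_hodgePQ_of_neg_eq_comp (hr : 1 ≤ r)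
    (A : HodgeModel (2 * r) (fermatHypersurface (2 * r) m)) {α : Fin (2 * r + 2) → ZMod m} (hα : α ≠ 0)
    (σ : Equiv.Perm (Fin (2 * r + 2))) (hσ : -α = α ∘ σ)
    {c : complexBetti (fermatHypersurface (2 * r) m) (2 * r)} (hc : c ∈ fermatEigenspace m α (2 * r)) :
    A.pullback (2 * r) c ∈ A.hodgePQ (2 * r) r r := by
  have hX : IsSmoothProjective (2 * r) (fermatHypersurface (2 * r) m) :=
    isSmoothProjective_fermatHypersurface (by omega) NeZero.one_le
  have hT := fermatGroup_le_diagonalStabilizer (n := 2 * r) m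
  obtain ⟨v, hv⟩ := fermatEigenspace_le_span_of_ne_zero (m := m) (NeZero.ne m) hr 0 hα
  refine pullback_mem_hodgePQ_of_eigenspace (fermatPolynomial ℂ (2 * r) m) hT (fermatCharacter m α) hX A
    (fun i hi hne x hx hxA => ?_) hc
  obtain ⟨p, q⟩ := i
  have hsum : p + q = 2 * r := Finset.HasAntidiagonal.mem_antidiagonal.1 hi
  have hpq : p ≠ q := by
    rintro rfl
    exact hne (Prod.ext (by change p = r; omega) (by change p = r; omega))
  -- `y = p_σ^* (conj x) ∈ V(α)` of type `(q,p)`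
  have hconj : conjClass (ComplexPoints (fermatHypersurface (2 * r) m)) (2 * r) x ∈
      fermatEigenspace m (α ∘ σ) (2 * r) := by
    rw [← hσ]
    exact conjClass_mem_fermatEigenspace hx
  have hy := map_permMap_mem_fermatEigenspace_of_comp σ hconj
  have hconjA : A.pullback (2 * r) (conjClass (ComplexPoints (fermatHypersurface (2 * r) m)) (2 * r) x) ∈
      A.hodgePQ (2 * r) q p := by
    rw [A.pullback_conjClass]
    exact A.isHodgeSymmetric hX (2 * r) p q _ hxA
  have hyA : A.pullback (2 * r) (singularCohomology.map ℂ ℂ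
      (permMap (fermatPolynomial ℂ (2 * r) m) (mem_permStabilizer_fermatPolynomial m σ)) (2 * r)
        (conjClass (ComplexPoints (fermatHypersurface (2 * r) m)) (2 * r) x)) ∈ A.hodgePQ (2 * r) q p :=
    A.pullback_map_mem_hodgePQ_of_endomorphism hX (permAut _ (mem_permStabilizer_fermatPolynomial m σ)) hconjA
  -- rank one
  obtain ⟨a, ha⟩ := Submodule.mem_span_singleton.mp (hv hx)
  obtain ⟨b, hb⟩ := Submodule.mem_span_singleton.mp (hv hy)
  by_cases hb0 : b = 0
  · have hy0 : singularCohomology.map ℂ ℂ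
        (permMap (fermatPolynomial ℂ (2 * r) m) (mem_permStabilizer_fermatPolynomial m σ)) (2 * r)
          (conjClass (ComplexPoints (fermatHypersurface (2 * r) m)) (2 * r) x) = 0 := by
      rw [← hb, hb0, zero_smul]
    have h1 : conjClass (ComplexPoints (fermatHypersurface (2 * r) m)) (2 * r) x = 0 :=
      map_permMap_injective σ (2 * r) (by rw [hy0, map_zero])
    rw [← conjClass_conjClass x, h1, conjClass_zero]
  · have hxy : x = (a / b) • singularCohomology.map ℂ ℂ
        (permMap (fermatPolynomial ℂ (2 * r) m) (mem_permStabilizer_fermatPolynomial m σ)) (2 * r)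
          (conjClass (ComplexPoints (fermatHypersurface (2 * r) m)) (2 * r) x) := by
      rw [← hb, smul_smul, div_mul_cancel₀ a hb0, ha]
    have hxA' : A.pullback (2 * r) x ∈ A.hodgePQ (2 * r) q p := by
      rw [hxy, map_smul]
      exact Submodule.smul_mem _ _ hyA
    exact DworkSextic.eq_zero_of_pullback_mem_hodgePQ_of_ne A hsum (by omega)
      (fun h => hpq (Prod.ext_iff.mp h).1) hxA hxA'

/-- Multiset form: **if the multisets of values of `α ≠ 0` and of `-α` coincide, `V(α) ⊆ H^{r,r}`**
(tuples with the same value multiset differ by a permutation, `exists_perm_eq_comp_of_univ_val_map_eq`).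
[cite: Shioda1979PJA, §4] [cite: Ran1980, §1 Prop. 1.7 (i)–(iii)] -/
theorem fermatEigenspace_pullback_mem_hodgePQ_of_univ_val_map_neg (hr : 1 ≤ r)
    (A : HodgeModel (2 * r) (fermatHypersurface (2 * r) m)) {α : Fin (2 * r + 2) → ZMod m} (hα : α ≠ 0)
    (hsym : univ.val.map (-α) = univ.val.map α)
    {c : complexBetti (fermatHypersurface (2 * r) m) (2 * r)} (hc : c ∈ fermatEigenspace m α (2 * r)) :
    A.pullback (2 * r) c ∈ A.hodgePQ (2 * r) r r := by
  classical
  obtain ⟨σ, hσ⟩ := FermatCharacter.exists_perm_eq_comp_of_univ_val_map_eq hsym.symm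
  exact fermatEigenspace_pullback_mem_hodgePQ_of_neg_eq_comp hr A hα σ hσ hc

/-- `∃`-model form: under the same hypotheses every class of `V(α)` `IsOfHodgeType (2r) X²ʳₘ (2r) r r`
(Hodge models exist, `nonempty_hodgeModel_holds`). [cite: Ran1980, §1 Prop. 1.7 (ii)] -/
theorem isOfHodgeType_of_mem_fermatEigenspace_of_univ_val_map_neg (hr : 1 ≤ r)
    {α : Fin (2 * r + 2) → ZMod m} (hα : α ≠ 0) (hsym : univ.val.map (-α) = univ.val.map α)
    {c : complexBetti (fermatHypersurface (2 * r) m) (2 * r)} (hc : c ∈ fermatEigenspace m α (2 * r)) :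
    IsOfHodgeType (2 * r) (fermatHypersurface (2 * r) m) (2 * r) r r c := by
  obtain ⟨A⟩ := nonempty_hodgeModel_holds (n := 2 * r) (X := fermatHypersurface (2 * r) m)
    (isSmoothProjective_fermatHypersurface (by omega) NeZero.one_le)
  exact ⟨A, fermatEigenspace_pullback_mem_hodgePQ_of_univ_val_map_neg hr A hα hsym hc⟩

end Fermat

/-! ### §2 The Fermat sextic fourfold: `Γ_W`-eigenspaces with symmetric totally nonzero translates -/

namespace DworkSextic

/-- **A `Γ_W`-eigenspace of `H⁴(X⁴₆(ℂ); ℂ)` all of whose totally nonzero translates are symmetric is of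
type `(2,2)`.** Let `e : Fin 6 → ℕ` be an exponent vector, not constant mod `6`, such that for every
`r ∈ ℤ/6` for which `e + r·𝟙 (mod 6)` is totally nonzero the value multisets of `e + r·𝟙` and
`-(e + r·𝟙)` agree. Then the `Γ_W`-eigenspace of `χ_e` in `H⁴(X⁴₆(ℂ); ℂ)` pulls back into `H^{2,2}_A`
for every Hodge model `A` of `X⁴₆`: it lies in the sum of the torus lines `V(α)` with
`χ_α|_{Γ_W} = χ_e` (`fermat_gammaW_eigenspace_le`), i.e. `α = e + r·𝟙` (`exists_translate_of_character_eq`);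
`α ≠ 0` as `e` is not constant; a translate with a zero coordinate has `V(α) = 0`
(`fermatEigenspace_eq_bot_of_apply_eq_zero`), a totally nonzero one is symmetric and §1 applies. This is
the Fermat-point evaluation in Katz's proof of Lemma 3.1(2), for the symmetric types.
[cite: Katz2009, Lemma 3.1 (proof, p. 8)] [cite: Shioda1979PJA, §4] [cite: Ran1980, §1 Prop. 1.7] -/
theorem fermat_gammaW_eigenspace_pullback_mem_hodgePQ_two_two (A : HodgeModel 4 (fermatHypersurface 4 6))
    {e : Fin 6 → ℕ} (hnc : ∃ i j, (e i : ZMod 6) ≠ (e j : ZMod 6))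
    (hsym : ∀ r : ZMod 6, IsTotallyNonzero (translate e r) →
      univ.val.map (-translate e r) = univ.val.map (translate e r))
    {c : complexBetti (fermatHypersurface 4 6) (2 * 2)}
    (hc : c ∈ diagonalCharacterEigenspace (fermatPolynomial ℂ 4 6) gammaW (character e) (2 * 2)) :
    A.pullback (2 * 2) c ∈ A.hodgePQ (2 * 2) 2 2 := by
  classical
  have hle := fermat_gammaW_eigenspace_le (character e)
  suffices h : (⨆ (α : Fin (4 + 2) → ZMod 6)
      (_ : (fermatCharacter 6 α).comp (Subgroup.inclusion gammaW_le_fermatGroup) = character e),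
      fermatEigenspace 6 α (2 * 2)) ≤ (A.hodgePQ (2 * 2) 2 2).comap (A.pullback (2 * 2)).hom from
    h (hle hc)
  refine iSup₂_le fun α hα x hx => ?_
  rw [Submodule.mem_comap]
  change A.pullback (2 * 2) x ∈ A.hodgePQ (2 * 2) 2 2
  rw [fermatCharacter_comp_inclusion] at hα
  obtain ⟨r, hr⟩ := exists_translate_of_character_eq hα
  simp only [ZMod.natCast_val, ZMod.cast_id', id_eq] at hr
  -- `α = e + r·𝟙 (mod 6) = translate e r`
  have hαt : α = translate e r := funext fun i => by rw [hr i]; rfl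
  have hα0 : α ≠ 0 := by
    obtain ⟨i, j, hij⟩ := hnc
    intro h0
    have hi := hr i
    have hj := hr j
    rw [h0, Pi.zero_apply] at hi hj
    exact hij (add_right_cancel (hi.symm.trans hj))
  by_cases htot : IsTotallyNonzero (translate e r)
  · have hs := hsym r htot
    rw [← hαt] at hs
    exact fermatEigenspace_pullback_mem_hodgePQ_of_univ_val_map_neg (m := 6) (r := 2) (by norm_num) A hα0
      hs hx
  · obtain ⟨i, hi⟩ : ∃ i, translate e r i = 0 := by
      by_contra h
      exact htot fun i h0 => h ⟨i, h0⟩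
    rw [← hαt] at hi
    rw [fermatEigenspace_eq_bot_of_apply_eq_zero (m := 6) (by norm_num) (r := 2) (by norm_num) hα0 hi] at hx
    rw [(Submodule.mem_bot ℂ).mp hx, map_zero]
    exact Submodule.zero_mem _

/-! ### §3 Katz's flat types `(1,2,3,3,4,5)`, `(1,1,2,4,5,5)`, `(1,1,3,3,5,5)` and their conjugates -/

/-- Permuting the coordinates permutes the translates: `translate (e ∘ σ) r = (translate e r) ∘ σ`.
[cite: Katz2009, §2 p. 6] -/
theorem translate_comp_perm (e : Fin 6 → ℕ) (σ : Equiv.Perm (Fin 6)) (r : ZMod 6) :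
    translate (fun l => e (σ l)) r = (translate e r) ∘ σ := rfl

/-- The symmetry hypothesis of `fermat_gammaW_eigenspace_pullback_mem_hodgePQ_two_two` is invariant under
permutations of the coordinates. [cite: Katz2009, Lemma 3.1] -/
theorem translate_symmetric_comp_perm {e : Fin 6 → ℕ}
    (hsym : ∀ r : ZMod 6, IsTotallyNonzero (translate e r) →
      univ.val.map (-translate e r) = univ.val.map (translate e r))
    (σ : Equiv.Perm (Fin 6)) :
    ∀ r : ZMod 6, IsTotallyNonzero (translate (fun l => e (σ l)) r) →
      univ.val.map (-translate (fun l => e (σ l)) r) = univ.val.map (translate (fun l => e (σ l)) r) := by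
  intro r htot
  rw [translate_comp_perm] at htot ⊢
  have htot' : IsTotallyNonzero (translate e r) := fun i => by
    simpa using htot (σ.symm i)
  have hneg : -(translate e r ∘ σ) = (-translate e r) ∘ σ := rfl
  rw [hneg, univ_val_map_comp_perm, univ_val_map_comp_perm]
  exact hsym r htot'

/-- **The flat types `j = 0, 2, 3` have symmetric totally nonzero translates** (and so do their
conjugates `6 − e`): the totally nonzero translates are `(1,2,3,3,4,5)`; `(1,1,2,4,5,5)`, `(4,4,5,1,2,2)`;
`(1,1,3,3,5,5)`, `(3,3,5,5,1,1)`, `(5,5,1,1,3,3)`, each with value multiset stable under negation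
(a `decide`). The type `j = 1`, `(1,2,2,3,5,5)`, fails this (`-(1,2,2,3,5,5) = (5,4,4,3,1,1)`).
[cite: Katz2009, Lemma 3.1] -/
theorem flatTypes_translate_symmetric (j : Fin 4) (hj : j ≠ 1) :
    (∀ r : ZMod 6, IsTotallyNonzero (translate (flatTypes j) r) →
      univ.val.map (-translate (flatTypes j) r) = univ.val.map (translate (flatTypes j) r)) ∧
    (∀ r : ZMod 6, IsTotallyNonzero (translate (fun l => 6 - flatTypes j l) r) →
      univ.val.map (-translate (fun l => 6 - flatTypes j l) r) =
        univ.val.map (translate (fun l => 6 - flatTypes j l) r)) := by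
  fin_cases j
  · exact ⟨by decide, by decide⟩
  · exact absurd rfl hj
  · exact ⟨by decide, by decide⟩
  · exact ⟨by decide, by decide⟩

/-- The flat types are not constant mod `6` (coordinates `0` and `5` differ), in every position.
[cite: Katz2009, Lemma 3.1] -/
theorem flatTypes_comp_perm_not_const (j : Fin 4) (σ : Equiv.Perm (Fin 6)) :
    (∃ i i', (flatTypes j (σ i) : ZMod 6) ≠ (flatTypes j (σ i') : ZMod 6)) ∧
    (∃ i i', ((6 - flatTypes j (σ i) : ℕ) : ZMod 6) ≠ ((6 - flatTypes j (σ i') : ℕ) : ZMod 6)) := by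
  obtain ⟨h, h'⟩ := flatTypes_zero_ne_five j
  exact ⟨⟨σ.symm 0, σ.symm 5, by simpa using h⟩, ⟨σ.symm 0, σ.symm 5, by simpa using h'⟩⟩

/-- **At the Fermat point the `Γ_W`-pieces of the flat types `(1,2,3,3,4,5)`, `(1,1,2,4,5,5)`,
`(1,1,3,3,5,5)` (Katz's types `j = 0, 2, 3`, in every position `σ ∈ 𝔖₆`) and of their conjugates
`6 − e` are pure of Hodge type `(2,2)`**: for every Hodge model `A` of `X⁴₆`, the `Γ_W`-eigenspaces of
`χ_{e∘σ}` and `χ_{(6−e)∘σ}` in `H⁴(X⁴₆(ℂ); ℂ)` pull back into `H^{2,2}_A`. This is Katz's Lemma 3.1(2) at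
`ψ = 0` for these types (`rank = #{totally nonzero translates} = 1, 2, 3`, all of degree `3`), proved
from symmetry alone; the type `(1,2,2,3,5,5) ~ (1,1,3,4,4,5)` (`j = 1`) is not covered.
[cite: Katz2009, Lemma 3.1] [cite: Shioda1979PJA, §4] [cite: Ran1980, §1 Prop. 1.7] -/
theorem fermat_flatTypes_gammaW_eigenspace_pullback_mem_hodgePQ_two_two (j : Fin 4) (hj : j ≠ 1)
    (σ : Equiv.Perm (Fin 6)) (A : HodgeModel 4 (fermatHypersurface 4 6)) :
    (∀ c ∈ diagonalCharacterEigenspace (fermatPolynomial ℂ 4 6) gammaW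
        (character fun l => flatTypes j (σ l)) (2 * 2), A.pullback (2 * 2) c ∈ A.hodgePQ (2 * 2) 2 2) ∧
    (∀ c ∈ diagonalCharacterEigenspace (fermatPolynomial ℂ 4 6) gammaW
        (character fun l => 6 - flatTypes j (σ l)) (2 * 2), A.pullback (2 * 2) c ∈ A.hodgePQ (2 * 2) 2 2) := by
  obtain ⟨h1, h2⟩ := flatTypes_translate_symmetric j hj
  obtain ⟨hn1, hn2⟩ := flatTypes_comp_perm_not_const j σ
  exact ⟨fun c hc => fermat_gammaW_eigenspace_pullback_mem_hodgePQ_two_two A hn1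
      (translate_symmetric_comp_perm h1 σ) hc,
    fun c hc => fermat_gammaW_eigenspace_pullback_mem_hodgePQ_two_two A hn2
      (translate_symmetric_comp_perm (e := fun l => 6 - flatTypes j l) h2 σ) hc⟩

end DworkSextic

end Literature.AlgebraicGeometry.HodgeTheory

end
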